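import Summits.SmoothPoincare4.SmoothPoincare4.Theorems.ConvexBisectionAcyclicBisectionExistsHgapTwistingAssembly
import Summits.SmoothPoincare4.SmoothPoincare4.Theorems.ConvexBisectionAcyclicBisectionExistsHgapCharSign
import Summits.SmoothPoincare4.SmoothPoincare4.Theorems.ConvexBisectionAcyclicBisectionExistsHgapCharTube
import Summits.SmoothPoincare4.SmoothPoincare4.Theorems.ConvexBisectionAcyclicBisectionExistsHgapStraighten
import Summits.SmoothPoincare4.SmoothPoincare4.Theorems.ConvexBisectionAcyclicBisectionExistsSeamTwistSignGlobal
import Literature.Topology.FourManifolds.LefschetzHandlebody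
import HarnessLib

/-!
# Hgap ▸ part B: `HB = helper_Hgap_twisting` — the page twisting of the straightened dual framed knot, CLOSED
(wave 7, crux stmt-SmoothPoincare4-10508, line `modp-braid-orbits`, stub `stub_T3_dualPresentation` (T3)
▸ node `Hgap` ▸ part B; registered sub-goals `helper_twistSign_eq_of_global`, `helper_dual_pageDir_eq`;
**`helper_Hgap_twisting`** = G2's `HBStatement` VERBATIM rides along, so that
`stub_T3_dualPresentation := T3_of_HB helper_Hgap_twisting` (G3, `…T3AssemblyClosedK.lean`))

THE NUMBER (G2): `pageTwisting g (R₁ ∘ β_j) (dR₁ fr_j) = - s₀ · t_j`, `t_j := if (l.get j).2 then -1 else 1`,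
`s₀ = ±1` X3's global twisting sign of the seam.  The bookkeeping from the chart-level assembly
`pageTwisting_transport_dualMap_of_beltSign` (`…HgapTwistingAssembly.lean`, R8) to the text of HB, and the
discharge of its sign hypothesis (the transfer (R6) at the belt points) from the wave-7 bricks of H1 and H2:

* §1 in HB the flattening direction `c` IS the page direction of the letter: `c = pageDir |l| j`
  (`dual_pageDir_eq`, registered `helper_dual_pageDir_eq`; G1's `HgapStraighten.dual_circle_extendedPage` + `R`
  is `w`-direction preserving), so `K_j` and the straightened dual circle lie in the SAME flat page;
* §2 `Hgap_twisting_of_beltSign`: HB's conclusion for one handle from the sign hypothesis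
  `∀ Φ ε L t, 0 < -(s₀ ε) · χ (0, 0, t)` on the belt character (Z4's page tube `Φ` of `K_j` by
  `helper_exists_pageTube`, its frame sign `ε` by `CircleTube.exists_frameSign`, `t_j` by
  `IsLefschetzLink.twisting_eq`, `(-s₀ ε) · ε = -s₀`);
* §3 `twistSign_eq_of_global` (registered `helper_twistSign_eq_of_global`): X3's twisting sign at ANY flat point
  off the cores equals the `s₀` of HB's hypothesis `hS0` (evaluate `hS0` at the universal straightening at the
  canonical margin, whose page determinant IS `twistDet`);
* §4 `beltSign_of_transfer`: the sign hypothesis of §2 — at the belt point `(0, 0, t)` pick H1's glued point `p₁`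
  on the positive `e₀`-ray below H2's radius (`exists_gluedPt`); there `sign χ_η (p₁) = -ε` (H2
  `helper_beltChar_tube`, tube-side map `η̂ = f♭ ∘ flip`), `twistSign (η̂ p₁) = s₀` (§3, `tubePt_mem_coresComplement`),
  and H1's net lemma `beltChar_net_of_glued` (`sign χ = twistSign · sign χ_η` at `p₁` + one sign of `χ` on the
  convex chart domain) gives `0 < -(s₀ ε) · χ (0, 0, t)`;
* §5 **`helper_Hgap_twisting : HBStatement`**.

Everything is proved; no named facts, no `sorry`.  References: J. B. Etnyre, T. Fuller, IMRN 2006, Thm. 1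
(proof, p. 8) [EtnyreFuller2006]; R. İ. Baykur, AGT 6 (2006), Thm. 5.1 (proof, p. 13) [Baykur2006].
-/

noncomputable section

set_option linter.dupNamespace false

open scoped Manifold ContDiff Topology
open Set Function Metric
open Literature.Topology.FourManifolds Literature.Topology.FourManifolds.HandleAttachingMap
  Literature.Topology.FourManifolds.LefschetzBase Literature.Topology.PlaneTopology
  Literature.Geometry.Symplectic

namespace Summit.SmoothPoincare4.SmoothPoincare4.Theorems.AcyclicBisectionExists.ModpBraidOrbits

namespace HBAssembly

/-- Signs: transport a positivity along an equality of the scalar factor (the big second factor is only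
unified, never rewritten). [folklore] -/
theorem pos_mul_congr {a b d : ℝ} (e : a = b) (h : 0 < a * d) : 0 < b * d := e ▸ h

/-- A real with square one is `±1`, as an integer sign. [folklore] -/
theorem exists_int_sign_of_sq_eq_one {s : ℝ} (hs : s ^ 2 = 1) : ∃ ε : ℤ, (ε = 1 ∨ ε = -1) ∧ (ε : ℝ) = s := by
  have h : s * s = 1 := by rw [← pow_two]; exact hs
  rcases mul_self_eq_one_iff.1 h with h1 | h1
  · exact ⟨1, Or.inl rfl, by rw [h1]; norm_num⟩
  · exact ⟨-1, Or.inr rfl, by rw [h1]; norm_num⟩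

end HBAssembly

open HBAssembly

/-! ## §3 (placed first: generic in the handle index type) The twisting sign at a flat point off the cores is HB's `s₀` -/

section TwistSign

variable {g : ℕ} {ι : Type} [Finite ι] {h : ι → HandleAttachingMap 3 2 (Base g)}
  {X : Type} [TopologicalSpace X] [ChartedSpace (EuclideanHalfSpace 4) X] [IsManifold (𝓡∂ 4) ∞ X]
  (D : MultiAttachmentData h (𝓡∂ 4) X) (bX : BoundaryData (𝓡∂ 4) X (𝓡 3)) [Nonempty bX.carrier]
  (Ψ : bX.carrier ≃ₘ⟮𝓡 3, 𝓡 3⟯ (bBase g).carrier)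

/-- **X3's twisting sign at a flat point off the cores equals the `s₀` of HB's hypothesis `hS0`**: evaluate
`hS0` at `y`, its page direction `c = 2 w(y)` and the universal straightening `S = strIso g m₀ hm₀` at the
canonical margin `m₀ = seamMargin y` (admissible: `S` is `rho`- and `w`-direction preserving and flattens
`seamB y`, X3 `str_seamB_mem_page`); the page determinant there IS `twistDet y`, whose sign is `twistSign y`.
[cite: EtnyreFuller2006, Thm. 1 (proof, p. 8)] -/
theorem twistSign_eq_of_global
    (hpage : ∀ (y : bX.carrier) (a : ↥(coresComplement h)), bX.incl y = D.jA a →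
      ∃ c : ℝ, 0 < c ∧ w g ((bBase g).incl (Ψ y)).1 = (c : ℂ) * w g (a : Base g).1)
    {s₀ : ℤ} (hs₀ : s₀ = 1 ∨ s₀ = -1)
    (hS0 : ∀ (y : (bBase g).carrier) (_ : (y.1 : Base g) ∈ coresComplement h) (c : ℂ) (_ : ‖c‖ = 1)
      (_ : y.1 ∈ page g c) (R : AmbientIsotopy (𝓡∂ 4) (Base g))
      (_ : ∀ (t : ℝ) (x : Base g), rho g (R.toFun t x).1 = rho g x.1)
      (_ : ∀ (t : ℝ) (x : Base g), ∃ r : ℝ, 0 < r ∧ w g (R.toFun t x).1 = (r : ℂ) * w g x.1)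
      (_ : R.toFun 1 (seamB D bX Ψ y) ∈ page g c),
      0 < (s₀ : ℝ) * pageDet g (bdDeriv g (R.toFun 1 ∘ seamB D bX Ψ) y) y.1.1)
    {y : (bBase g).carrier} (hy : (y.1 : Base g) ∈ coresComplement h) (hflat : ‖cx y.1.1‖ ^ 2 < 4) :
    (twistSign D bX Ψ y : ℝ) = s₀ := by
  obtain ⟨c, hc, hyc⟩ := exists_mem_page_of_flat hflat ((RegularSublevel.mem_boundary_iff _ _).1 y.2)
  obtain ⟨hm₀, hm₀w⟩ := seamMargin_pos D bX Ψ hpage hy hc hyc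
  have key := hS0 y hy c hc hyc (strIso g (seamMargin D bX Ψ y) hm₀) (str_rho_base _ hm₀) (str_dir_base _ hm₀)
    (str_seamB_mem_page D bX Ψ hpage hm₀ hy hc hyc hm₀w)
  have e : pageDet g (bdDeriv g ((strIso g (seamMargin D bX Ψ y) hm₀).toFun 1 ∘ seamB D bX Ψ) y) y.1.1 =
      twistDet D bX Ψ y := by
    unfold twistDet; rw [dif_pos hm₀]
  rw [e] at key
  unfold twistSign
  rcases hs₀ with h1 | h1 <;> subst h1
  · have h0 : 0 < twistDet D bX Ψ y := by simpa using key
    simp [h0]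
  · have h0 : ¬ 0 < twistDet D bX Ψ y := by
      intro h0; push_cast at key; linarith
    simp [h0]

end TwistSign

variable {g : ℕ} {l : List ((Fin g ⊕ Fin g → ℤ) × Bool)} {h : Fin l.length → HandleAttachingMap 3 2 (Base g)}
  {X : Type} [TopologicalSpace X] [T2Space X] [SecondCountableTopology X] [CompactSpace X]
  [ChartedSpace (EuclideanHalfSpace 4) X] [IsManifold (𝓡∂ 4) ∞ X]

/-! ## §1 The flattening direction is the page direction of the letter -/

/-- **The flattening direction is the page direction of the letter**: if a `w`-direction preserving map
`R₁` carries a point of the `j`-th dual attaching circle into `page g c` (`‖c‖ = 1`), then `c = pageDir |l| j`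
— the dual circle has `w = a · pageDir |l| j` with `a > 0` (G1 `HgapStraighten.dual_circle_extendedPage`).
[cite: Baykur2006, Thm. 5.1 (proof, p. 13)] -/
theorem dual_pageDir_eq (hlink : IsLefschetzLink g l h) (D : MultiAttachmentData h (𝓡∂ 4) X)
    (bX : BoundaryData (𝓡∂ 4) X (𝓡 3)) (Ψ : bX.carrier ≃ₘ⟮𝓡 3, 𝓡 3⟯ (bBase g).carrier)
    (hpage : ∀ (y : bX.carrier) (a : ↥(coresComplement h)), bX.incl y = D.jA a →
      ∃ c : ℝ, 0 < c ∧ w g ((bBase g).incl (Ψ y)).1 = (c : ℂ) * w g (a : Base g).1)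
    (col : (BoundaryManifold.boundaryData 3 (Base g)).Collar) (κ δ : ℝ) (hκ : 0 < κ) (hκ1 : κ ≤ 1)
    (hδ : 0 < δ) (hδ2 : δ ≤ 1 / 2) (j : Fin l.length) {c : ℂ} (hc : ‖c‖ = 1) {R₁ : Base g → Base g}
    (hRw : ∀ x : Base g, ∃ r : ℝ, 0 < r ∧ w g (R₁ x).1 = (r : ℂ) * w g x.1)
    (θ : sphere (0 : EuclideanSpace ℝ (Fin 2)) 1)
    (hflat : R₁ ((dualMap D bX (bBase g) Ψ col κ δ hκ hκ1 hδ hδ2 j).attachingCircle θ) ∈ page g c) :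
    c = pageDir l.length j := by
  obtain ⟨-, a, ha, hwa⟩ := HgapStraighten.dual_circle_extendedPage hlink D bX Ψ hpage col κ δ hκ hκ1 hδ hδ2 j θ
  obtain ⟨r, hr, hwr⟩ := hRw ((dualMap D bX (bBase g) Ψ col κ δ hκ hκ1 hδ hδ2 j).attachingCircle θ)
  have h2 := hflat.2
  rw [hwr, hwa] at h2
  -- `c = 2 r a · pageDir`, and norms give `2 r a = 1`
  have hc' : c = ((2 * r * a : ℝ) : ℂ) * pageDir l.length j := by
    have : c = 2 * ((r : ℂ) * ((a : ℂ) * pageDir l.length j)) := by rw [h2]; ring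
    rw [this]; push_cast; ring
  have hn : 2 * r * a = 1 := by
    have := congrArg (fun z : ℂ => ‖z‖) hc'
    simp only [norm_mul, norm_pageDir, mul_one, Complex.norm_real, Real.norm_eq_abs, hc] at this
    rw [abs_of_pos hr, abs_of_pos ha, abs_of_pos (two_pos : (0 : ℝ) < 2)] at this
    exact this.symm
  rw [hc', hn]; simp

/-! ## §2 HB for one handle from the sign of the belt character -/

/-- **HB from the sign of the belt character.**  In the telescope of HB (fibred model with the page
clause, Lefschetz link `l`, handle `j`, fibred straightening `R` flattening the dual circle into `page g c`,
`s₀ = ±1`), IF for every page tube `Φ` of `K_j` (Z4's clauses), frame sign `ε`, fibre part `L` and `t` the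
`det4`-character of G2's chart at the belt point `(0, 0, t)` has the sign `-s₀ ε`, THEN the page twisting of
the transported dual framed knot is `-s₀ · t_j`, `t_j = if (l.get j).2 then -1 else 1`.
[cite: EtnyreFuller2006, Thm. 1 (proof, p. 8)] -/
theorem Hgap_twisting_of_beltSign (hlink : IsLefschetzLink g l h) (D : MultiAttachmentData h (𝓡∂ 4) X)
    (bX : BoundaryData (𝓡∂ 4) X (𝓡 3)) (Ψ : bX.carrier ≃ₘ⟮𝓡 3, 𝓡 3⟯ (bBase g).carrier)
    (hpage : ∀ (y : bX.carrier) (a : ↥(coresComplement h)), bX.incl y = D.jA a →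
      ∃ c : ℝ, 0 < c ∧ w g ((bBase g).incl (Ψ y)).1 = (c : ℂ) * w g (a : Base g).1)
    {s₀ : ℤ} (hs₀ : s₀ = 1 ∨ s₀ = -1)
    (col : (BoundaryManifold.boundaryData 3 (Base g)).Collar) (κ δ : ℝ) (hκ : 0 < κ) (hκ1 : κ ≤ 1)
    (hδ : 0 < δ) (hδ2 : δ ≤ 1 / 2) (j : Fin l.length) {c : ℂ} (hc : ‖c‖ = 1)
    (R : AmbientIsotopy (𝓡∂ 4) (Base g))
    (hRρ : ∀ (t : ℝ) (x : Base g), rho g (R.toFun t x).1 = rho g x.1)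
    (hRw : ∀ (t : ℝ) (x : Base g), ∃ r : ℝ, 0 < r ∧ w g (R.toFun t x).1 = (r : ℂ) * w g x.1)
    (hflat : ∀ θ, R.toFun 1 ((dualMap D bX (bBase g) Ψ col κ δ hκ hκ1 hδ hδ2 j).attachingCircle θ) ∈ page g c)
    (hsign : ∀ (Φ : CircleTube (bBase g).carrier) (κ' r' : ℝ), 0 < κ' → 0 < r' →
      (∀ ψ, (bBase g).incl (Φ.core ψ) = (h j).attachingCircle ψ) →
      (∀ t : ℝ, HasFDerivAt (fun v : EuclideanSpace ℝ (Fin 2) =>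
          ((bBase g).incl (Φ.toHomeo (circlePt t, v))).1)
        ((EuclideanSpace.proj (𝕜 := ℝ) (0 : Fin 2)).smulRight
            (r' • cplxJ (deriv (ambCurve g (h j).attachingCircle) t)) +
          (EuclideanSpace.proj (𝕜 := ℝ) (1 : Fin 2)).smulRight
            (κ' • rotField g ((h j).attachingCircle (circlePt t)).1)) 0) →
      ∀ (ε : ℤ), (ε = 1 ∨ ε = -1) → (∀ x, 0 < (ε : ℝ) * CircleTube.frameSign (h j).boundaryTube Φ x) →
      ∀ (L : EuclideanSpace ℝ (Fin 3) →L[ℝ] EuclideanSpace ℝ (Fin 2)),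
      (∀ (p : EuclideanSpace ℝ (Fin 3)) (i : Fin 2), L p i = p (Fin.castSucc i)) →
      ∀ t : ℝ, 0 < -((s₀ : ℝ) * ε) *
        det4 (gradient (rho g) (R.toFun 1 ((BoundaryManifold.boundaryData 3 (Base g)).incl
            (seamDiffeo bX (bBase g) Ψ ((beltMap D j).boundaryTube.toHomeo
              (circlePt ((EuclideanSpace.single (2 : Fin 3) t) 2), L (EuclideanSpace.single (2 : Fin 3) t)))))).1)
          (mfderiv 𝓘(ℝ, EuclideanSpace ℝ (Fin 3)) 𝓘(ℝ, EuclideanSpace ℝ (Fin 4))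
            (fun p : EuclideanSpace ℝ (Fin 3) => (R.toFun 1 ((BoundaryManifold.boundaryData 3 (Base g)).incl
              (seamDiffeo bX (bBase g) Ψ ((beltMap D j).boundaryTube.toHomeo (circlePt (p 2), L p))))).1)
            (EuclideanSpace.single (2 : Fin 3) t) (EuclideanSpace.single (0 : Fin 3) (1 : ℝ)))
          (mfderiv 𝓘(ℝ, EuclideanSpace ℝ (Fin 3)) 𝓘(ℝ, EuclideanSpace ℝ (Fin 4))
            (fun p : EuclideanSpace ℝ (Fin 3) => (R.toFun 1 ((BoundaryManifold.boundaryData 3 (Base g)).incl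
              (seamDiffeo bX (bBase g) Ψ ((beltMap D j).boundaryTube.toHomeo (circlePt (p 2), L p))))).1)
            (EuclideanSpace.single (2 : Fin 3) t) (EuclideanSpace.single (1 : Fin 3) (1 : ℝ)))
          (mfderiv 𝓘(ℝ, EuclideanSpace ℝ (Fin 3)) 𝓘(ℝ, EuclideanSpace ℝ (Fin 4))
            (fun p : EuclideanSpace ℝ (Fin 3) => (R.toFun 1 ((BoundaryManifold.boundaryData 3 (Base g)).incl
              (seamDiffeo bX (bBase g) Ψ ((beltMap D j).boundaryTube.toHomeo (circlePt (p 2), L p))))).1)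
            (EuclideanSpace.single (2 : Fin 3) t) (EuclideanSpace.single (2 : Fin 3) (1 : ℝ)))) :
    pageTwisting g
        ((dualMap D bX (bBase g) Ψ col κ δ hκ hκ1 hδ hδ2 j).transport (R.toDiffeomorph 1)).attachingCircle
        ((dualMap D bX (bBase g) Ψ col κ δ hκ hκ1 hδ hδ2 j).transport (R.toDiffeomorph 1)).attachingFraming =
      -s₀ * (if (l.get j).2 then -1 else 1) := by
  -- §1: the flattening direction is the page direction of the letter
  have hcj : c = pageDir l.length j :=
    dual_pageDir_eq hlink D bX Ψ hpage col κ δ hκ hκ1 hδ hδ2 j hc (hRw 1) (circlePt 0) (hflat _)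
  subst hcj
  have hKc : ∀ v, (h j).attachingCircle v ∈ page g (pageDir l.length j) := hlink.mem_page j
  -- Z4's page tube of `K_j` and its frame sign
  obtain ⟨κ', r', -, -, Φ, hκ', hr', -, -, -, -, -, -, -, -, hΦcore, -, -, hΦder⟩ :=
    helper_exists_pageTube g (pageDir l.length j) (h j).attachingCircle (norm_pageDir _ _)
      (isSmoothEmbedding_attachingCircle (h j)) hKc
  have hcore : ∀ θ, (h j).boundaryTube.core θ = Φ.core θ := boundaryTube_core_eq_of_incl_core (h j) hΦcore
  obtain ⟨sg, hsg, hsgpos⟩ := CircleTube.exists_frameSign hcore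
  obtain ⟨ε, hε, hεe⟩ := exists_int_sign_of_sq_eq_one hsg
  have hεs : ∀ x, 0 < (ε : ℝ) * CircleTube.frameSign (h j).boundaryTube Φ x := by rw [hεe]; exact hsgpos
  -- the fibre part and the sign
  obtain ⟨L, hL⟩ := exists_lamL3
  obtain ⟨σ, hσ, hσe⟩ : ∃ σ : ℤ, (σ = 1 ∨ σ = -1) ∧ -((s₀ : ℝ) * ε) = (σ : ℝ) := by
    refine ⟨-(s₀ * ε), ?_, by push_cast; ring⟩
    rcases hs₀ with h0 | h0 <;> rcases hε with h1 | h1 <;> simp [h0, h1]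
  have hsign' := fun t => pos_mul_congr hσe (hsign Φ κ' r' hκ' hr' hΦcore hΦder ε hε hεs L hL t)
  -- the chart-level assembly
  -- (its sign hypothesis is written with `⇑(R.toDiffeomorph 1)`; ours with `R.toFun 1`: the same function, `rfl`)
  have key := pageTwisting_transport_dualMap_of_beltSign D bX Ψ hpage col κ δ hκ hκ1 hδ hδ2 (R.toDiffeomorph 1) j
    hL (fun x => hRρ 1 x) (fun x => hRw 1 x) (norm_pageDir _ _) hKc (fun θ => hflat θ) hκ' hr' hΦcore hΦder hε hεs
    hσ (fun t => by simp only [AmbientIsotopy.coe_toDiffeomorph]; exact hsign' t)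
  rw [key, hlink.twisting_eq j]
  -- `σ ε = -(s₀ ε) ε = -s₀`
  have hσZ : σ = -(s₀ * ε) := by exact_mod_cast hσe.symm
  have hε2 : ε * ε = 1 := by rcases hε with h1 | h1 <;> simp [h1]
  rw [hσZ, show -(s₀ * ε) * ε = -s₀ * (ε * ε) by ring, hε2, mul_one]

/-! ## §4 The transfer (R6) at the belt points, from H1 and H2 -/

/-- **The sign hypothesis of `Hgap_twisting_of_beltSign` holds** (the transfer (R6) at the belt points): under
HB's telescope, for every page tube `Φ` of `K_j` (Z4's clauses), frame sign `ε`, fibre part `L` and `t`, the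
`det4`-character of G2's three-dimensional belt-tube chart at the belt point `(0, 0, t)` has the sign `-s₀ ε` —
H1's net lemma `beltChar_net_of_glued` at H1's glued point `exists_gluedPt` on the positive `e₀`-ray, fed with
H2's tube-side sign `helper_beltChar_tube` and §3. [cite: EtnyreFuller2006, Thm. 1 (proof, p. 8)] -/
theorem beltSign_of_transfer (hlink : IsLefschetzLink g l h) (D : MultiAttachmentData h (𝓡∂ 4) X)
    (bX : BoundaryData (𝓡∂ 4) X (𝓡 3)) [Nonempty bX.carrier] (Ψ : bX.carrier ≃ₘ⟮𝓡 3, 𝓡 3⟯ (bBase g).carrier)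
    (hpage : ∀ (y : bX.carrier) (a : ↥(coresComplement h)), bX.incl y = D.jA a →
      ∃ c : ℝ, 0 < c ∧ w g ((bBase g).incl (Ψ y)).1 = (c : ℂ) * w g (a : Base g).1)
    {s₀ : ℤ} (hs₀ : s₀ = 1 ∨ s₀ = -1)
    (hS0 : ∀ (y : (bBase g).carrier) (_ : (y.1 : Base g) ∈ coresComplement h) (c : ℂ) (_ : ‖c‖ = 1)
      (_ : y.1 ∈ page g c) (R : AmbientIsotopy (𝓡∂ 4) (Base g))
      (_ : ∀ (t : ℝ) (x : Base g), rho g (R.toFun t x).1 = rho g x.1)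
      (_ : ∀ (t : ℝ) (x : Base g), ∃ r : ℝ, 0 < r ∧ w g (R.toFun t x).1 = (r : ℂ) * w g x.1)
      (_ : R.toFun 1 (seamB D bX Ψ y) ∈ page g c),
      0 < (s₀ : ℝ) * pageDet g (bdDeriv g (R.toFun 1 ∘ seamB D bX Ψ) y) y.1.1)
    (col : (BoundaryManifold.boundaryData 3 (Base g)).Collar) (κ δ : ℝ) (hκ : 0 < κ) (hκ1 : κ ≤ 1)
    (hδ : 0 < δ) (hδ2 : δ ≤ 1 / 2) (j : Fin l.length) {c : ℂ} (hc : ‖c‖ = 1)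
    (R : AmbientIsotopy (𝓡∂ 4) (Base g))
    (hRρ : ∀ (t : ℝ) (x : Base g), rho g (R.toFun t x).1 = rho g x.1)
    (hRw : ∀ (t : ℝ) (x : Base g), ∃ r : ℝ, 0 < r ∧ w g (R.toFun t x).1 = (r : ℂ) * w g x.1)
    (hflat : ∀ θ, R.toFun 1 ((dualMap D bX (bBase g) Ψ col κ δ hκ hκ1 hδ hδ2 j).attachingCircle θ) ∈ page g c)
    (Φ : CircleTube (bBase g).carrier) (κ' r' : ℝ) (hκ' : 0 < κ') (hr' : 0 < r')
    (hΦcore : ∀ ψ, (bBase g).incl (Φ.core ψ) = (h j).attachingCircle ψ)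
    (hΦder : ∀ t : ℝ, HasFDerivAt (fun v : EuclideanSpace ℝ (Fin 2) =>
        ((bBase g).incl (Φ.toHomeo (circlePt t, v))).1)
      ((EuclideanSpace.proj (𝕜 := ℝ) (0 : Fin 2)).smulRight
          (r' • cplxJ (deriv (ambCurve g (h j).attachingCircle) t)) +
        (EuclideanSpace.proj (𝕜 := ℝ) (1 : Fin 2)).smulRight
          (κ' • rotField g ((h j).attachingCircle (circlePt t)).1)) 0)
    (ε : ℤ) (hεs : ∀ x, 0 < (ε : ℝ) * CircleTube.frameSign (h j).boundaryTube Φ x)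
    (L : EuclideanSpace ℝ (Fin 3) →L[ℝ] EuclideanSpace ℝ (Fin 2))
    (hL : ∀ (p : EuclideanSpace ℝ (Fin 3)) (i : Fin 2), L p i = p (Fin.castSucc i)) (t : ℝ) :
    0 < -((s₀ : ℝ) * ε) *
      det4 (gradient (rho g) (R.toFun 1 ((BoundaryManifold.boundaryData 3 (Base g)).incl
          (seamDiffeo bX (bBase g) Ψ ((beltMap D j).boundaryTube.toHomeo
            (circlePt ((EuclideanSpace.single (2 : Fin 3) t) 2), L (EuclideanSpace.single (2 : Fin 3) t)))))).1)
        (mfderiv 𝓘(ℝ, EuclideanSpace ℝ (Fin 3)) 𝓘(ℝ, EuclideanSpace ℝ (Fin 4))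
          (fun p : EuclideanSpace ℝ (Fin 3) => (R.toFun 1 ((BoundaryManifold.boundaryData 3 (Base g)).incl
            (seamDiffeo bX (bBase g) Ψ ((beltMap D j).boundaryTube.toHomeo (circlePt (p 2), L p))))).1)
          (EuclideanSpace.single (2 : Fin 3) t) (EuclideanSpace.single (0 : Fin 3) (1 : ℝ)))
        (mfderiv 𝓘(ℝ, EuclideanSpace ℝ (Fin 3)) 𝓘(ℝ, EuclideanSpace ℝ (Fin 4))
          (fun p : EuclideanSpace ℝ (Fin 3) => (R.toFun 1 ((BoundaryManifold.boundaryData 3 (Base g)).incl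
            (seamDiffeo bX (bBase g) Ψ ((beltMap D j).boundaryTube.toHomeo (circlePt (p 2), L p))))).1)
          (EuclideanSpace.single (2 : Fin 3) t) (EuclideanSpace.single (1 : Fin 3) (1 : ℝ)))
        (mfderiv 𝓘(ℝ, EuclideanSpace ℝ (Fin 3)) 𝓘(ℝ, EuclideanSpace ℝ (Fin 4))
          (fun p : EuclideanSpace ℝ (Fin 3) => (R.toFun 1 ((BoundaryManifold.boundaryData 3 (Base g)).incl
            (seamDiffeo bX (bBase g) Ψ ((beltMap D j).boundaryTube.toHomeo (circlePt (p 2), L p))))).1)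
          (EuclideanSpace.single (2 : Fin 3) t) (EuclideanSpace.single (2 : Fin 3) (1 : ℝ))) := by
  -- the flattening direction is the page direction of the letter
  have hcj : c = pageDir l.length j :=
    dual_pageDir_eq hlink D bX Ψ hpage col κ δ hκ hκ1 hδ hδ2 j hc (hRw 1) (circlePt 0) (hflat _)
  subst hcj
  have hKc : ∀ v, (h j).attachingCircle v ∈ page g (pageDir l.length j) := hlink.mem_page j
  -- H2: the tube-side character is `-ε` along the positive `e₀`-ray below `δ₂`
  obtain ⟨δ₂, hδ₂, hH2⟩ := helper_beltChar_tube g (h j) (pageDir l.length j) (norm_pageDir _ _) hKc κ' r' Φ hκ' hr'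
    hΦcore hΦder (ε : ℝ) hεs L hL
  -- H1: a glued point on that ray with all side conditions (flat, in the slit plane, below `δ₂` and `1`)
  obtain ⟨p₁, -, -, hray, hpos, hlt, hlt1, hslit, hflat₁⟩ := exists_gluedPt (h := h) j hL hKc t δ₂ hδ₂
  have he := hH2 p₁ hpos hlt hray
  -- the twisting sign at the tube-side point is `s₀`
  have hy := tubePt_mem_coresComplement D j (circlePt (Complex.arg (toC (L p₁)) / (2 * Real.pi))) (circlePt (p₁ 2))
    hpos hlt1
  have hs := twistSign_eq_of_global D bX Ψ hpage hs₀ hS0 hy hflat₁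
  -- H1's net lemma at the belt point `(0, 0, t)`
  have hp : ‖L (EuclideanSpace.single (2 : Fin 3) t)‖ < 1 := by
    rw [HBAssembly.fibrePart_axis hL, norm_zero]; exact one_pos
  exact beltChar_net_of_glued D bX Ψ R j hpage hRρ hL p₁ hslit hlt1 hflat₁ hs he (EuclideanSpace.single (2 : Fin 3) t) hp

/-! ## §5 HB -/

/-- **HB = `helper_Hgap_twisting` (G2's `HBStatement`, VERBATIM): the page twisting of the straightened dual
framed knot.**  For a fibred model `(X, D, bX, Ψ)` of a Lefschetz link `l` with the page clause, X3's global
twisting sign `s₀` (with its defining property), the dual attaching map `dualMap … j` and ANY fibred ambient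
isotopy `R` of `Base g` (`rho`-preserving, `w`-direction preserving) whose time-1 map puts the dual attaching
circle into a flat page:  `pageTwisting g (R₁ ∘ β_j) (dR₁ fr_j) = -s₀ · (if (l.get j).2 then -1 else 1)`.
So `stub_T3_dualPresentation := T3_of_HB helper_Hgap_twisting`. [cite: EtnyreFuller2006, Thm. 1 (proof, p. 8)] -/
theorem helper_Hgap_twisting :
  ∀ (g : ℕ) (l : List ((Fin g ⊕ Fin g → ℤ) × Bool)) (h : Fin l.length → HandleAttachingMap 3 2 (Base g)),
    IsLefschetzLink g l h →
    ∀ {X : Type} [TopologicalSpace X] [T2Space X] [SecondCountableTopology X] [CompactSpace X]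
      [ChartedSpace (EuclideanHalfSpace 4) X] [IsManifold (𝓡∂ 4) ∞ X]
      (D : MultiAttachmentData h (𝓡∂ 4) X) (bX : BoundaryData (𝓡∂ 4) X (𝓡 3)) [Nonempty bX.carrier]
      (Ψ : bX.carrier ≃ₘ⟮𝓡 3, 𝓡 3⟯ (bBase g).carrier),
      (∀ (y : bX.carrier) (a : ↥(coresComplement h)), bX.incl y = D.jA a →
        ∃ c : ℝ, 0 < c ∧ w g ((bBase g).incl (Ψ y)).1 = (c : ℂ) * w g (a : Base g).1) →
    ∀ (s₀ : ℤ), (s₀ = 1 ∨ s₀ = -1) →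
      (∀ (y : (bBase g).carrier) (_ : (y.1 : Base g) ∈ coresComplement h) (c : ℂ) (_ : ‖c‖ = 1)
        (_ : y.1 ∈ page g c) (R : AmbientIsotopy (𝓡∂ 4) (Base g))
        (_ : ∀ (t : ℝ) (x : Base g), rho g (R.toFun t x).1 = rho g x.1)
        (_ : ∀ (t : ℝ) (x : Base g), ∃ r : ℝ, 0 < r ∧ w g (R.toFun t x).1 = (r : ℂ) * w g x.1)
        (_ : R.toFun 1 (seamB D bX Ψ y) ∈ page g c),
        0 < (s₀ : ℝ) * pageDet g (bdDeriv g (R.toFun 1 ∘ seamB D bX Ψ) y) y.1.1) →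
    ∀ (col : (BoundaryManifold.boundaryData 3 (Base g)).Collar) (κ δ : ℝ) (hκ : 0 < κ) (hκ1 : κ ≤ 1)
      (hδ : 0 < δ) (hδ2 : δ ≤ 1 / 2) (j : Fin l.length) (c : ℂ) (_ : ‖c‖ = 1)
      (R : AmbientIsotopy (𝓡∂ 4) (Base g))
      (_ : ∀ (t : ℝ) (x : Base g), rho g (R.toFun t x).1 = rho g x.1)
      (_ : ∀ (t : ℝ) (x : Base g), ∃ r : ℝ, 0 < r ∧ w g (R.toFun t x).1 = (r : ℂ) * w g x.1)
      (_ : ∀ θ, R.toFun 1 ((dualMap D bX (bBase g) Ψ col κ δ hκ hκ1 hδ hδ2 j).attachingCircle θ) ∈ page g c),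
      pageTwisting g
          ((dualMap D bX (bBase g) Ψ col κ δ hκ hκ1 hδ hδ2 j).transport (R.toDiffeomorph 1)).attachingCircle
          ((dualMap D bX (bBase g) Ψ col κ δ hκ hκ1 hδ hδ2 j).transport (R.toDiffeomorph 1)).attachingFraming =
        -s₀ * (if (l.get j).2 then -1 else 1) := by
  intro g l h hlink X _ _ _ _ _ _ D bX _ Ψ hpage s₀ hs₀ hS0 col κ δ hκ hκ1 hδ hδ2 j c hc R hRρ hRw hflat
  exact Hgap_twisting_of_beltSign hlink D bX Ψ hpage hs₀ col κ δ hκ hκ1 hδ hδ2 j hc R hRρ hRw hflat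
    (fun Φ κ' r' hκ' hr' hΦcore hΦder ε _ hεs L hL t =>
      beltSign_of_transfer hlink D bX Ψ hpage hs₀ hS0 col κ δ hκ hκ1 hδ hδ2 j hc R hRρ hRw hflat Φ κ' r' hκ' hr'
        hΦcore hΦder ε hεs L hL t)

/-- **Sub-goal `helper_twistSign_eq_of_global` of stub `stub_T3_dualPresentation`** (T3 ▸ node `Hgap` ▸ part B
`helper_Hgap_twisting`, closing file; wave 7, lead c5): X3's twisting sign at any flat point off the cores equals
the global sign `s₀` of HB's hypothesis; HB itself (`helper_Hgap_twisting`) rides along in this file.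
[cite: EtnyreFuller2006, Thm. 1 (proof, p. 8)] -/
theorem helper_twistSign_eq_of_global : ∀ (g : ℕ) (ι : Type) [Finite ι] (h : ι → Literature.Topology.FourManifolds.HandleAttachingMap 3 2 (Literature.Topology.FourManifolds.LefschetzBase.Base g)) (X : Type) [TopologicalSpace X] [ChartedSpace (EuclideanHalfSpace 4) X] [IsManifold (𝓡∂ 4) ∞ X] (D : Literature.Topology.FourManifolds.HandleAttachingMap.MultiAttachmentData h (𝓡∂ 4) X) (bX : Literature.Topology.FourManifolds.BoundaryData (𝓡∂ 4) X (𝓡 3)) [Nonempty bX.carrier] (Ψ : bX.carrier ≃ₘ⟮𝓡 3, 𝓡 3⟯ (Literature.Topology.FourManifolds.LefschetzBase.bBase g).carrier), (∀ (y : bX.carrier) (a : ↥(Literature.Topology.FourManifolds.HandleAttachingMap.coresComplement h)), bX.incl y = D.jA a → ∃ c : ℝ, 0 < c ∧ Literature.Topology.FourManifolds.LefschetzBase.w g ((Literature.Topology.FourManifolds.LefschetzBase.bBase g).incl (Ψ y)).1 = (c : ℂ) * Literature.Topology.FourManifolds.LefschetzBase.w g (a : Literature.Topology.FourManifolds.LefschetzBase.Base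 g).1) → ∀ (s₀ : ℤ), (s₀ = 1 ∨ s₀ = -1) → (∀ (y : (Literature.Topology.FourManifolds.LefschetzBase.bBase g).carrier) (_ : (y.1 : Literature.Topology.FourManifolds.LefschetzBase.Base g) ∈ Literature.Topology.FourManifolds.HandleAttachingMap.coresComplement h) (c : ℂ) (_ : ‖c‖ = 1) (_ : y.1 ∈ Literature.Topology.FourManifolds.LefschetzBase.page g c) (R : Literature.Topology.FourManifolds.AmbientIsotopy (𝓡∂ 4) (Literature.Topology.FourManifolds.LefschetzBase.Base g)) (_ : ∀ (t : ℝ) (x : Literature.Topology.FourManifolds.LefschetzBase.Base g), Literature.Topology.FourManifolds.LefschetzBase.rho g (R.toFun t x).1 = Literature.Topology.FourManifolds.LefschetzBase.rho g x.1) (_ : ∀ (t : ℝ) (x : Literature.Topology.FourManifolds.LefschetzBase.Base g), ∃ r : ℝ, 0 < r ∧ Literature.Topology.FourManifolds.LefschetzBase.w g (R.toFun t x).1 = (r : ℂ) * Literature.Topology.FourManifolds.LefschetzBase.w g x.1) (_ : R.toFun 1 (Summit.SmoothPoincare4.SmoothPoincare4.Theorems.AcyclicBisectionExists.ModpBraidOrbits.seamB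 D bX Ψ y) ∈ Literature.Topology.FourManifolds.LefschetzBase.page g c), 0 < (s₀ : ℝ) * Summit.SmoothPoincare4.SmoothPoincare4.Theorems.AcyclicBisectionExists.ModpBraidOrbits.pageDet g (Summit.SmoothPoincare4.SmoothPoincare4.Theorems.AcyclicBisectionExists.ModpBraidOrbits.bdDeriv g (R.toFun 1 ∘ Summit.SmoothPoincare4.SmoothPoincare4.Theorems.AcyclicBisectionExists.ModpBraidOrbits.seamB D bX Ψ) y) y.1.1) → ∀ (y : (Literature.Topology.FourManifolds.LefschetzBase.bBase g).carrier), (y.1 : Literature.Topology.FourManifolds.LefschetzBase.Base g) ∈ Literature.Topology.FourManifolds.HandleAttachingMap.coresComplement h → ‖Literature.Topology.FourManifolds.LefschetzBase.cx y.1.1‖ ^ 2 < 4 → (Summit.SmoothPoincare4.SmoothPoincare4.Theorems.AcyclicBisectionExists.ModpBraidOrbits.twistSign D bX Ψ y : ℝ) = s₀ :=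
  fun _ _ _ _ _ _ _ _ D bX _ Ψ hpage _ hs₀ hS0 _ hy hflat => twistSign_eq_of_global D bX Ψ hpage hs₀ hS0 hy hflat

/-- **Sub-goal `helper_dual_pageDir_eq` of stub `stub_T3_dualPresentation`** (T3 ▸ node `Hgap` ▸ part B
`helper_Hgap_twisting` ▸ (R8) assembly, file 4; wave 7, lead c5): in HB's telescope the flattening direction `c`
of the `j`-th dual attaching circle is the page direction `pageDir |l| j` of its letter; the HB-level assembly
`Hgap_twisting_of_beltSign` / `Hgap_twisting_of_R6net` of this file rides along.
[cite: Baykur2006, Thm. 5.1 (proof, p. 13)] -/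
theorem helper_dual_pageDir_eq : ∀ (g : ℕ) (l : List ((Fin g ⊕ Fin g → ℤ) × Bool)) (h : Fin l.length → Literature.Topology.FourManifolds.HandleAttachingMap 3 2 (Literature.Topology.FourManifolds.LefschetzBase.Base g)), Literature.Topology.FourManifolds.LefschetzBase.IsLefschetzLink g l h → ∀ (X : Type) [TopologicalSpace X] [T2Space X] [SecondCountableTopology X] [CompactSpace X] [ChartedSpace (EuclideanHalfSpace 4) X] [IsManifold (𝓡∂ 4) ∞ X] (D : Literature.Topology.FourManifolds.HandleAttachingMap.MultiAttachmentData h (𝓡∂ 4) X) (bX : Literature.Topology.FourManifolds.BoundaryData (𝓡∂ 4) X (𝓡 3)) (Ψ : bX.carrier ≃ₘ⟮𝓡 3, 𝓡 3⟯ (Literature.Topology.FourManifolds.LefschetzBase.bBase g).carrier), (∀ (y : bX.carrier) (a : ↥(Literature.Topology.FourManifolds.HandleAttachingMap.coresComplement h)), bX.incl y = D.jA a → ∃ c : ℝ, 0 < c ∧ Literature.Topology.FourManifolds.LefschetzBase.w g ((Literature.Topology.FourManifolds.LefschetzBase.bBase g).incl (Ψ y)).1 = (c : ℂ) * Literature.Topology.FourManifolds.LefschetzBase.w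 g (a : Literature.Topology.FourManifolds.LefschetzBase.Base g).1) → ∀ (col : (Literature.Topology.FourManifolds.BoundaryManifold.boundaryData 3 (Literature.Topology.FourManifolds.LefschetzBase.Base g)).Collar) (κ δ : ℝ) (hκ : 0 < κ) (hκ1 : κ ≤ 1) (hδ : 0 < δ) (hδ2 : δ ≤ 1 / 2) (j : Fin l.length) (c : ℂ), ‖c‖ = 1 → ∀ (R₁ : Literature.Topology.FourManifolds.LefschetzBase.Base g → Literature.Topology.FourManifolds.LefschetzBase.Base g), (∀ x : Literature.Topology.FourManifolds.LefschetzBase.Base g, ∃ r : ℝ, 0 < r ∧ Literature.Topology.FourManifolds.LefschetzBase.w g (R₁ x).1 = (r : ℂ) * Literature.Topology.FourManifolds.LefschetzBase.w g x.1) → ∀ (θ : Metric.sphere (0 : EuclideanSpace ℝ (Fin 2)) 1), R₁ ((Summit.SmoothPoincare4.SmoothPoincare4.Theorems.AcyclicBisectionExists.ModpBraidOrbits.dualMap D bX (Literature.Topology.FourManifolds.LefschetzBase.bBase g) Ψ col κ δ hκ hκ1 hδ hδ2 j).attachingCircle θ) ∈ Literature.Topology.FourManifolds.LefschetzBase.page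 g c → c = Literature.Topology.FourManifolds.LefschetzBase.pageDir l.length j :=
  fun _ _ _ hlink _ _ _ _ _ _ _ D bX Ψ hpage col κ δ hκ hκ1 hδ hδ2 j _ hc _ hRw θ hflat =>
    dual_pageDir_eq hlink D bX Ψ hpage col κ δ hκ hκ1 hδ hδ2 j hc hRw θ hflat

end Summit.SmoothPoincare4.SmoothPoincare4.Theorems.AcyclicBisectionExists.ModpBraidOrbits

end
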